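import Summits.ABC.IUTFork.Thm311LinkCompat
import Mathlib.Algebra.Group.Pointwise.Set.Basic
import Mathlib.Algebra.GroupWithZero.Basic
import Mathlib.Data.Nat.Factorial.BigOperators
import HarnessLib

/-!
# [IUTchIII] Theorem 3.11 in the author's terms, F: Remarks 3.11.1–3.11.4 (the typable content)

Record-only file (D-0012) of the abc-iut cell (seat abc-iut-c312-1); TAKES NO SIDE. Sequel to
`Thm311Sig`/`Thm311Multirad`/`Thm311LogKummer`/`Thm311LinkCompat` (A–D). Remarks 3.11.1–3.11.4 (kurims
pp. 159–173) are for the most part INTERPRETIVE prose ((IPL), (SHE), (APT), (HIS); "vertically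
once-shifted"; "invisible indeterminacies"); LANA Rem. 8.2.1 (p. 42) records that (IPL)/(SHE)/(APT) as
printed are not formal statements. This file types what has kernel content at the level of A–D and
RECORDS the rest by locator, so that every node of the census slice has a status:

| node | status | where |
|---|---|---|
| Rmk 3.11.1 (i) p. 159 (summary of Thm 3.11 as an algorithm describing the theta values of one vertical line in terms of another, up to mild indeterminacies) | typed as reading | `Situation.MultiradialCompat` (B); `mem_RLGP_of_multiradialCompat` |
| Rmk 3.11.1 (ii) pp. 159–160 (input = an `F⊩▶×μ`-prime-strip up to isomorphism; functoriality in it; the codomain's `q`-pilot strip is "coric") | TYPED | `MRData.RLGP_map_eq` (output class invariant under the indeterminacy automorphisms) |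
| Rmk 3.11.1 (iii) (IPL) p. 160 | TYPED (reading) + shadow | `LinkData.IPL`, `LinkData.ipl_iff_nonempty` |
| Rmk 3.11.1 (iii) (SHE) p. 161, (iv) (APT)/(HIS) p. 162, (v) p. 163 | NOTED | kernel shadow of (SHE): `MRData` lives on the coric `LogShells` (B); no further decl |
| Rmk 3.11.1 (vi)–(viii) pp. 163–166 (naive link `q ↦ q^λ`; distinct labels vs forced identification; trivial multiradial representation `{q^{λ^n}}`) | TYPED (toy) | `naiveRep`, `pow_iter_mem_naiveRep` |
| Rmk 3.11.2 (i) p. 167 (tautological approach to multiradiality, [IUTchII] Ex. 1.9 (ii)) | NOTED | = "regarded up to (Ind1), (Ind2)" = `MRData.RLGP` (B) |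
| Rmk 3.11.2 (ii) pp. 167–168 (labels vs naked index sets; `j+1` possibilities, total `(l⋇+1)! = l^±!`) | TYPED | `ThetaIndex.Caps` (A) are naked `Fin (j+1)`; `labelIdentifications_card` |
| Rmk 3.11.2 (iii), (iv) pp. 168–169 (why `F^⊛_MOD` not `D^⊩`; splitting monoids at good `v` omitted) | NOTED | design of `MRData` (b) = bad `v` only (B) |
| Rmk 3.11.3 (i)–(iv) pp. 169–171 (squares not 1-commutative; commute w.r.t. bi-coric data; once-shifted; summary) | NOTED | kernel shadow of (i): the bi-coric strictification of `LogShells` (A) |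
| Rmk 3.11.4 (i) pp. 171–172 (data (ii)(b),(c) only up to roots of unity; these stabilize the SETS, Figs. 3.4, 3.5) | TYPED | `orbitSet_smul_eq` (sets of orbits are stable), `mul_ne_self_of_ne_one` (specific elements are not) |
| Rmk 3.11.4 (ii) pp. 172–173 (Kummer isomorphisms determined by cyclotome isos + Galois action, [FrdII] Def. 2.1 (ii)) | NOTED | TODO-merge: abc-iut-L1-t4 ([FrdII] §2) |
| Rmk 3.11.4 (iii) p. 173 (invisible indeterminacies ~ analogue of (Ind3) for (b),(c)) | NOTED | — |
| census rows "Rmk 3.11.4 (viii)", "Rmk 3.9.3 (i)/(xi)/(xii) p. 181" | ARTEFACTS | no such sub-items on those pages (Rmk 3.11.4 has (i)–(iii); p. 181 is Cor. 3.12's proof citing Rmk 3.9.3) — reported to abc-iut-dag |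

Sources read on the page: [IUTchIII] pp. 159–173. [claim: Mochizuki2012, status: disputed]
[cite: LANA2026Report, Rem. 8.2.1 p. 42]
Deliberately NOT here: any formalisation of (SHE)/(APT)/(HIS) beyond the shadows named; any judgement.
-/

noncomputable section

namespace Summit.ABC

namespace IUTFork

namespace Thm311

open CategoryTheory
open scoped Pointwise

variable {T : ThetaIndex}

/-! ## Rmk 3.11.1 (ii): functoriality in the input prime-strip, at the level of the class `R^LGP` -/

/-- The indeterminacy moves generate the same class from `D` and from any transport `D.map Φ` of it by an
(Ind1)- or (Ind2)-family: the OUTPUT of the algorithm — the class `^{n,∘}R^{LGP}` — is invariant under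
the automorphisms acting on its presentation. This is the kernel content, at this level, of Rmk. 3.11.1
(ii) (pp. 159–160): "the functorial construction algorithm for the Θ-pilot object up to certain mild
indeterminacies [i.e., (Ind1), (Ind2), (Ind3)] … may be regarded as an algorithm whose input data is an
`F⊩▶×μ`-prime-strip …, and whose functoriality is with respect to arbitrary isomorphisms of the
`F⊩▶×μ`-prime-strips that appear as input data of the algorithm". [claim: Mochizuki2012, status: disputed] -/
theorem MRData.RLGP_map_eq {L : LogShells T} (D : MRData L) (Φ : L.PacketAut)
    (hΦ : Φ ∈ L.Ind1Family ∨ Φ ∈ L.Ind2Family) : (D.map Φ).RLGP = D.RLGP :=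
  ((D.map Φ).RLGP_eq_iff D).2 (Relation.EqvGen.symm _ _ (Relation.EqvGen.rel _ _ ⟨Φ, hΦ, rfl⟩))

/-! ## Rmk 3.11.1 (iii) (IPL): "linked via full poly-isomorphisms" -/

namespace LinkData

variable (K : LinkData)

/-- **(IPL)** (Rmk. 3.11.1 (iii), p. 160): "This output data is constructed in such a way that it is
linked/related, via full poly-isomorphisms of `F⊩▶×μ`-prime-strips induced by operations in the algorithm,
to the input data prime-strip, i.e., the "coric"/"fixed" `q`-pilot `F⊩▶×μ`-prime-strip". READING at the
level of `LinkData` (which carries the `F⊢×μ` portions `^{n,m}F⊢×μ_△` of these strips): consecutive strips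
are linked by a NONEMPTY full poly-isomorphism. LANA Rem. 8.2.1 (p. 42): "the assertion that two BPSs are
"linked," in the sense that there exists an isomorphism between them, is a vacuous assertion since the
category of BPSs is a connected groupoid" — see `ipl_iff_nonempty`: the only content is that the strips are
abstractly isomorphic. [claim: Mochizuki2012, status: disputed] -/
@[claim "Mochizuki2012" "disputed"] def IPL : Prop := ∀ n m : ℤ, (K.horizontal n m).Nonempty

/-- (IPL) as typed says exactly: the `F⊢×μ`-prime-strips of horizontally adjacent theaters are
isomorphic. [cite: LANA2026Report, Rem. 8.2.1 p. 42] -/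
theorem ipl_iff_nonempty : K.IPL ↔ ∀ n m : ℤ, Nonempty (K.Fdelta n m ≅ K.Fdelta (n + 1) m) := by
  refine forall_congr' fun n => forall_congr' fun m => ?_
  constructor
  · rintro ⟨f, -⟩; exact ⟨f⟩
  · rintro ⟨f⟩; exact ⟨f, Set.mem_univ f⟩

/-- (IPL) as typed holds as soon as the category of strips is CONNECTED (any two objects isomorphic) —
which the tree's prime-strip categories are by construction
(`Literature.IUT.LogThetaLattice.StripCat.iso_nonempty`, abc-iut-L6-t3: strips = `V`-indexed families
each isomorphic to a fixed model); this is LANA Rem. 8.2.1's "since the category of BPSs is a connected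
groupoid" at the level of `LinkData`. [cite: LANA2026Report, Rem. 8.2.1 p. 42] -/
theorem ipl_of_connected (h : ∀ X Y : K.Strip, Nonempty (X ≅ Y)) : K.IPL :=
  K.ipl_iff_nonempty.2 fun _ _ => h _ _

end LinkData

/-! ## Rmk 3.11.1 (vi)–(viii): the naive link `q ↦ q^λ` and its "trivial multiradial representation" -/

/-- The "trivial multiradial representation" of Rmk. 3.11.1 (vii) (p. 165): under "forced identification
of arithmetic holomorphic structures" the naive link `∗ ↦ q`, `∗ ↦ q^λ` forces one "to regard "`q`" as
being only well-defined up to possible confusion with "`q^{λ^n}`", for some indeterminate `n ∈ ℤ`" — typed,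
in a monoid, as the class of `q` under the equivalence relation generated by `x ∼ x^λ` (negative `n`
would need `λ`-th roots; the generated equivalence relation is the honest version).
[claim: Mochizuki2012, status: disputed] -/
def naiveRep {M : Type} [Monoid M] (lam : ℕ) (q : M) : Set M :=
  {x | Relation.EqvGen (fun a b : M => b = a ^ lam) q x}

/-- `q^{λ^n}` lies in the trivial multiradial representation of `q`, for every `n ∈ ℕ` (Rmk. 3.11.1
(vii): "`{q^{λ^n}}_{n ∈ ℤ}`", nonnegative half). [claim: Mochizuki2012, status: disputed] -/
theorem pow_iter_mem_naiveRep {M : Type} [Monoid M] (lam : ℕ) (q : M) (n : ℕ) :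
    q ^ lam ^ n ∈ naiveRep lam q := by
  induction n with
  | zero => simpa [naiveRep] using Relation.EqvGen.refl q
  | succ n ih =>
    refine Relation.EqvGen.trans _ _ _ ih (Relation.EqvGen.rel _ _ ?_)
    rw [pow_succ, pow_mul]

/-- In the "distinct labels" approach (Rmk. 3.11.1 (vii), p. 164) nothing identifies `†q` with `‡q^λ`:
inside ONE ring ("forced identification") the naive link is consistent with rigidity of `q` only if
`q^λ = q`, i.e. (in a domain) `q = 0` or `q^{λ−1} = 1` — the elementary reason the text gives for
passing to indeterminacies or to distinct labels. [folklore] -/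
theorem naiveLink_rigid_iff {K : Type} [Field K] (lam : ℕ) (hlam : 1 ≤ lam) (q : K) :
    q ^ lam = q ↔ q = 0 ∨ q ^ (lam - 1) = 1 := by
  obtain ⟨k, rfl⟩ := Nat.exists_eq_add_of_le hlam
  rw [Nat.add_sub_cancel_left, add_comm, pow_succ, mul_left_eq_self₀, or_comm]

/-! ## Rmk 3.11.2 (ii): naked index sets and the count of label identifications -/

/-- Rmk. 3.11.2 (ii) (p. 168): "for `j ∈ {0, …, l⋇}`, there are precisely `j+1` possibilities for the
"element labeled `j`" in the index set of cardinality `j+1`; this leads to a total of `(l⋇+1)! = l^±!`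
possibilities for the "label identification" of elements of index sets of capsules appearing in the
mono-analytic `±`-processions of Theorem 3.11, (i)." The index sets of `Thm311Sig` are the naked
`ThetaIndex.Caps j = Fin (j+1)` ("just "naked sets" which are determined, up to isomorphism, by their
cardinality"); the count, kernel-checked. [claim: Mochizuki2012, status: disputed] -/
theorem labelIdentifications_card (T : ThetaIndex) :
    ∏ j ∈ Finset.range (T.lstar + 1), Fintype.card (Fin (j + 1)) = Nat.factorial (T.lstar + 1) := by
  simp only [Fintype.card_fin]
  exact Finset.prod_range_add_one_eq_factorial (T.lstar + 1)

/-- `(l⋇ + 1)! = l^±!` with `l^± := l⋇ + 1 = (l+1)/2` ([IUTchI] §0). [claim: Mochizuki2012, status: disputed] -/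
theorem lpm_eq (T : ThetaIndex) : T.lstar + 1 = (T.l + 1) / 2 := by
  unfold ThetaIndex.l; omega

/-! ## Rmk 3.11.4 (i): invisible indeterminacies stabilize sets, not elements -/

/-- Rmk. 3.11.4 (i) (pp. 171–172), Figs. 3.4/3.5: "`μ_{2l} ↷ {q^{j²}}_{j=1,…,l⋇}`", "`μ(F^×_mod) ↷ F^×_mod ↶ {±1}`"
— multiplication by roots of unity "stabilizes the entire set [i.e., as opposed to specific elements of
this set]". Typed: for a subgroup `H` of a group acting on `X` and any `T ⊆ X`, the set of `H`-translates
`H·T` is stable under every `h ∈ H`. (Theta values: `H = μ_{2l}`, `T = {q^{j²}}`; number field: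
`H = μ(F_mod)`, `T = F^×_mod`, where `H·T = T`.) [claim: Mochizuki2012, status: disputed] -/
theorem orbitSet_smul_eq {G X : Type} [Group G] [MulAction G X] (H : Subgroup G) (S : Set X)
    {h : G} (hh : h ∈ H) :
    h • {x : X | ∃ g ∈ H, ∃ t ∈ S, x = g • t} = {x : X | ∃ g ∈ H, ∃ t ∈ S, x = g • t} := by
  ext x
  rw [Set.mem_smul_set]
  constructor
  · rintro ⟨y, ⟨g, hg, t, ht, rfl⟩, rfl⟩
    exact ⟨h * g, H.mul_mem hh hg, t, ht, (mul_smul h g t).symm⟩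
  · rintro ⟨g, hg, t, ht, rfl⟩
    exact ⟨(h⁻¹ * g) • t, ⟨h⁻¹ * g, H.mul_mem (H.inv_mem hh) hg, t, ht, rfl⟩,
      by rw [smul_smul, mul_inv_cancel_left]⟩

/-- … "as opposed to specific elements": in a field a root of unity `ζ ≠ 1` moves every nonzero element
(so the data of Thm. 3.11 (ii) (b), (c) "may only be considered up to multiplication by roots of unity",
i.e. as orbits). [folklore] -/
theorem mul_ne_self_of_ne_one {K : Type} [Field K] {ζ x : K} (hζ : ζ ≠ 1) (hx : x ≠ 0) : ζ * x ≠ x := by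
  intro h
  rcases mul_left_eq_self₀.mp h with h1 | h1
  · exact hζ h1
  · exact hx h1

end Thm311

end IUTFork

end Summit.ABC

end
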